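import Literature.AnabelianGeometry.EtaleTheta.FrobenioidTheta

/-!
# [EtTh] §5: Frobenioid-theoretic cyclotomic rigidity — Prop. 5.5, Thm. 5.6, Thm. 5.7 (pp. 327–330 / PDF pp. 101–104)

Mochizuki, *The étale theta function …*, Publ. RIMS **45** (2009) [cite: MochizukiEtTh2009, §5 p.327 (PDF p.101)].
Seat abc-iut-L2-t4.  Over the §5 data `ThetaFrobenioid` (`FrobenioidTheta.lean`,
`FrobenioidThetaBiKummer.lean`):
* the transport of cyclotomes `μ_N(T) → μ_N(S)` and of `(l·Δ_Θ)_S ⊗ ℤ/Nℤ → (l·Δ_Θ)_T ⊗ ℤ/Nℤ` along a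
  morphism `S → T` (REAL definitions from the stub transports), used to say "functorial";
* `FrobenioidCyclotomicRigidity.ThetaSubquotientProj` — `TODO-merge(abc-iut-L2-t2)`: the projection
  of (part of) `Aut_D(E)` onto the subquotient `(l·Δ_Θ)_E` (p.327 (PDF p.101)), needed to say that the Kummer
  class "determines" the isomorphism of Prop. 5.5 on `B_N`;
* **Proposition 5.5** (Frobenioid-theoretic Cyclotomic Rigidity): a candidate family of isomorphisms
  `ρ_S : (l·Δ_Θ)_S ⊗ ℤ/Nℤ ⥲ μ_N(S)` (`S` `(l,N)`-theta-saturated) is typed by the predicates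
  `IsKummerDetermined` ("the second Kummer class of Proposition 5.2, (iii), determines …") and
  `IsFunctorialLinear` ("functorial with respect to … the linear morphisms of `(l,N)`-theta-saturated
  objects"); the proposition is the existence (and uniqueness) of such a family;
* **Theorem 5.6** (Category-theoreticity of Frobenioid-theoretic Cyclotomic Rigidity): a
  self-equivalence `Ψ` preserves the theta-saturated objects and transports `ρ_S` to `ρ_{Ψ(S)}`
  (the transport of `(l·Δ_Θ)_S ⊗ ℤ/Nℤ` induced by `Ψ^bs` — Cor. 3.8 / [SemiAnbd] Prop. 3.2 — is a
  PARAMETER; on cyclotomes `Ψ` acts by `Ψ.mapAut`);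
* **Theorem 5.7** (Category-theoreticity of the Frobenioid-theoretic Theta Function): `Ψ` preserves
  the class of right fraction-pairs of "an `l`-th root of the theta function `Θ̈(√−1)⁻¹ · Θ̈` …
  [normalized so as to be 'of standard type'], up to possible multiplication by a `2l`-th root of
  unity and possible translation by an element of `ℤ` … or `l·ℤ`"; that class is abc-iut-L2-t3/t2/t1
  vocabulary and enters through the stub `FrobenioidCyclotomicRigidity.StdThetaPairStub`.

Remark 5.7.1 (p.330 (PDF p.104)) — NO decl (comparison/commentary): "the 'rigidity up to possible
multiplication by a `2l`-th root of unity' asserted in Theorem 5.7 is substantially stronger than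
[what was in effect] the preservation of `Θ̈` up to multiplication by an arbitrary constant function
`∈ O^×(−)` [cf. the '`u`' appearing in the proof of Theorem 5.6], that was observed by considering
divisors [i.e., Proposition 5.3, (vi)] in the proof of Theorem 5.6."
HONEST FRAMING: statements are `Prop`-valued predicates over interface data; typed ≠ proved.

v3 (R-9 repair, referee finding D4-F8 / RQ7 audit abc-iut-L6-t23 20:47:51Z, filed under the L2 succession
rule for abc-iut-L2-t4): `IsKummerDetermined` now reads `ρ_{B_N}` off PRINT's difference
`s^⊓-gp_N · (s^⊔-gp_N)⁻¹` (kurims p.83, `= κ_{f|B_N}`); v2 used the inverse difference.  Nothing else changed.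
-/

namespace Literature.AnabelianGeometry.EtaleTheta

open CategoryTheory

universe w v v' u u'

namespace ThetaFrobenioid

variable {C : Type u} [Category.{v} C] {D : Type u'} [Category.{v'} D] (𝔉 : ThetaFrobenioid.{w} C D)

/-! ### Transport of cyclotomes and of `(l·Δ_Θ)_S ⊗ ℤ/Nℤ` along morphisms -/

/-- Pull-back of cyclotomes along `φ : S → T`: `μ_M(T) → μ_M(S)`, the restriction of the pull-back
of units `O^×(T) → O^×(S)` (proof of Prop. 5.5, p.328 (PDF p.102): linear morphisms "induce isomorphisms …
`μ_N(S) ⥲ μ_N(S'')`").  [cite: MochizukiEtTh2009, Prop 5.5 proof p.328 (PDF p.102)] -/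
def muTorsionPull {S T : C} (φ : S ⟶ T) (M : ℕ) : 𝔉.muTorsion T M →* 𝔉.muTorsion S M where
  toFun u := ⟨(𝔉.unitsPull φ ⟨u.1, u.2.1⟩ : Aut S), (𝔉.unitsPull φ ⟨u.1, u.2.1⟩).2, by
    have h : (⟨u.1, u.2.1⟩ : 𝔉.units T) ^ M = 1 := Subtype.ext (by simpa using u.2.2)
    have := congrArg (fun x : 𝔉.units S => (x : Aut S)) (by rw [← map_pow, h, map_one] :
      𝔉.unitsPull φ ⟨u.1, u.2.1⟩ ^ M = 1)
    simpa using this⟩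
  map_one' := by
    apply Subtype.ext
    change ((𝔉.unitsPull φ ⟨(1 : Aut T), _⟩ : 𝔉.units S) : Aut S) = 1
    have : (⟨(1 : Aut T), (𝔉.muTorsion T M).one_mem.1⟩ : 𝔉.units T) = 1 := rfl
    rw [this, map_one]
    rfl
  map_mul' u w := by
    apply Subtype.ext
    change ((𝔉.unitsPull φ ⟨(u * w : 𝔉.muTorsion T M).1, _⟩ : 𝔉.units S) : Aut S) =
      ((𝔉.unitsPull φ ⟨u.1, u.2.1⟩ : 𝔉.units S) : Aut S) * ((𝔉.unitsPull φ ⟨w.1, w.2.1⟩ : 𝔉.units S) : Aut S)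
    have : (⟨(u * w : 𝔉.muTorsion T M).1, (u * w).2.1⟩ : 𝔉.units T) =
        ⟨u.1, u.2.1⟩ * ⟨w.1, w.2.1⟩ := rfl
    rw [this, map_mul]
    rfl

/-- Push-forward `(l·Δ_Θ)_S ⊗ ℤ/Nℤ → (l·Δ_Θ)_T ⊗ ℤ/Nℤ` along `φ : S → T`, induced by the transport
`(l·Δ_Θ)_{S^bs} → (l·Δ_Θ)_{T^bs}` along `φ^bs` (proof of Prop. 5.5, p.328 (PDF p.102): linear morphisms
"induce isomorphisms `(l·Δ_Θ)_{S''} ⊗ ℤ/Nℤ ⥲ (l·Δ_Θ)_S ⊗ ℤ/Nℤ`").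
[cite: MochizukiEtTh2009, Prop 5.5 proof p.328 (PDF p.102)] -/
def lDeltaModNMap {S T : C} (φ : S ⟶ T) : 𝔉.lDeltaModN S →* 𝔉.lDeltaModN T :=
  QuotientGroup.map _ _ (𝔉.lDeltaMap (𝔉.base.map φ)) (by
    rintro _ ⟨x, rfl⟩
    exact ⟨𝔉.lDeltaMap (𝔉.base.map φ) x, by simp [map_pow]⟩)

end ThetaFrobenioid

namespace FrobenioidCyclotomicRigidity

variable {C : Type u} [Category.{v} C] {D : Type u'} [Category.{v'} D]

/-- **LOCAL STUB — `TODO-merge(abc-iut-L2-t2)`.**  The subquotient structure of p.327 (PDF p.101) made explicit: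
"these subquotients determine subquotients `Aut_D(D) ↠ Aut^Θ_D(D)`; `(l·Δ_Θ)_D ⊆ Aut^Θ_D(D)`" — for
each `E ∈ Ob(D)`, the preimage `P_E ⊆ Aut_D(E)` of `(l·Δ_Θ)_E` and the projection `P_E ↠ (l·Δ_Θ)_E`.
(Supplements `FrobenioidTheta.ThetaSubquotientStub`; same owner.)
[cite: MochizukiEtTh2009, §5 p.327 (PDF p.101)] -/
structure ThetaSubquotientProj (𝔉 : ThetaFrobenioid.{w} C D) where
  /-- the preimage of `(l·Δ_Θ)_E ⊆ Aut^Θ_D(E)` in `Aut_D(E)` -/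
  pre : ∀ E : D, Subgroup (Aut E)
  /-- the projection onto the subquotient `(l·Δ_Θ)_E` -/
  proj : ∀ E : D, pre E →* 𝔉.lDelta E
  /-- it is surjective (a subquotient) -/
  proj_surjective : ∀ E, Function.Surjective (proj E)

variable (𝔉 : ThetaFrobenioid.{w} C D)

/-- A candidate **Frobenioid-theoretic cyclotomic rigidity family**: an isomorphism
`(l·Δ_Θ)_S ⊗ ℤ/Nℤ ⥲ μ_N(S)` for every `(l,N)`-theta-saturated `S ∈ Ob(C)` (the shape of the datum
Prop. 5.5 asserts to exist).  [cite: MochizukiEtTh2009, Prop 5.5 p.327 (PDF p.101)] -/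
abbrev RigidityFamily : Type (max u v w) :=
  ∀ S : C, 𝔉.IsThetaSaturated S → (𝔉.lDeltaModN S ≃* 𝔉.muTorsion S 𝔉.N)

/-- Prop. 5.5, clause "the second Kummer class of Proposition 5.2, (iii), determines an
isomorphism": on the `N`-codomain `B_N` (theta-saturated by hypothesis `hB`), the isomorphism `ρ_{B_N}`
is the one read off from the bi-Kummer difference cocycle `h ↦ s^⊓-gp_N(h) · s^⊔-gp_N(h)⁻¹` — PRINT's
orientation (Prop. 4.3 (iii), kurims p.83: "the difference `s^⊓-gp_N · (s^⊔-gp_N)^{-1}` … is equal to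
the Kummer class `κ_{f|B_N}`"; v3, R-9 repair of referee finding D4-F8: v2 read `ρ_{B_N}` off the INVERSE
difference, i.e. typed print's `ρ` composed with `x ↦ x⁻¹`) — restricted to the part of `H_{B_N}` lying
over `(l·Δ_Θ)_{B_N}` ("it follows from the detailed description of the 'étale theta class' in
Proposition 1.3 that the resulting Kummer class … determines an isomorphism", proof p.327 (PDF
p.101)–328).  [cite: MochizukiEtTh2009, Prop 5.5 p.327 (PDF p.101)] -/
def IsKummerDetermined (P : ThetaSubquotientProj 𝔉) (ρ : RigidityFamily 𝔉)
    (hB : 𝔉.IsThetaSaturated 𝔉.BN) : Prop :=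
  ∀ (h : 𝔉.HB) (hh : (h : Aut (𝔉.base.obj 𝔉.BN)) ∈ P.pre (𝔉.base.obj 𝔉.BN)),
    (ρ 𝔉.BN hB (QuotientGroup.mk (P.proj _ ⟨h, hh⟩)) : Aut 𝔉.BN) =
      𝔉.sgpCap (h : Aut (𝔉.base.obj 𝔉.BN)) * (𝔉.sgpCup h)⁻¹

/-- Prop. 5.5, clause "This isomorphism is functorial with respect to the subcategory of `C`
determined by the linear morphisms of `(l, N)`-theta-saturated objects": for a linear `φ : S → T`
between theta-saturated objects, pulling back `ρ_T` along `φ` gives `ρ_S`: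
`μ-pull(φ) ∘ ρ_T ∘ Δ-push(φ) = ρ_S`.  [cite: MochizukiEtTh2009, Prop 5.5 p.327 (PDF p.101)] -/
def IsFunctorialLinear (ρ : RigidityFamily 𝔉) : Prop :=
  ∀ {S T : C} (φ : S ⟶ T), 𝔉.IsLinear φ → ∀ (hS : 𝔉.IsThetaSaturated S)
    (hT : 𝔉.IsThetaSaturated T) (x : 𝔉.lDeltaModN S),
    𝔉.muTorsionPull φ 𝔉.N (ρ T hT (𝔉.lDeltaModNMap φ x)) = ρ S hS x

/-- **[EtTh] Proposition 5.5 (Frobenioid-theoretic Cyclotomic Rigidity)** (p.327 (PDF p.101)): "the second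
Kummer class of Proposition 5.2, (iii), determines an isomorphism
`(l·Δ_Θ)_S ⊗ ℤ/Nℤ ⥲ μ_N(S) (= l·μ_{l·N}(S))` for all `(l, N)`-theta-saturated `S ∈ Ob(C)`. This
isomorphism is functorial with respect to the subcategory of `C` determined by the linear morphisms
of `(l, N)`-theta-saturated objects."  Typed: there is a rigidity family that is Kummer-determined on
`B_N` and functorial for linear morphisms, and any two functorial Kummer-determined families agree
("independent of the choice of `S''`, `S'''` and the linear morphisms", proof p.328 (PDF p.102)).
[cite: MochizukiEtTh2009, Prop 5.5 p.327 (PDF p.101)] -/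
def CyclotomicRigidity (P : ThetaSubquotientProj 𝔉) (hB : 𝔉.IsThetaSaturated 𝔉.BN) : Prop :=
  (∃ ρ : RigidityFamily 𝔉, IsKummerDetermined 𝔉 P ρ hB ∧ IsFunctorialLinear 𝔉 ρ) ∧
    ∀ ρ ρ' : RigidityFamily 𝔉, IsKummerDetermined 𝔉 P ρ hB → IsFunctorialLinear 𝔉 ρ →
      IsKummerDetermined 𝔉 P ρ' hB → IsFunctorialLinear 𝔉 ρ' → ρ = ρ'

/-- The transport step of the proof of Prop. 5.5 (pp.327–328 (PDF pp.101–102)): every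
`(l,N)`-theta-saturated `S` receives a linear morphism from the `l·N`-codomain (here `B_N`) inducing
an isomorphism on `(l·Δ_Θ) ⊗ ℤ/Nℤ` and on `μ_N` ("linear morphisms `S'' → S` … which induce
isomorphisms …").  Named hypothesis (its source is [FrdI] Def. 1.3 (iii)(d) / the structure of `C`).
[cite: MochizukiEtTh2009, Prop 5.5 proof p.328 (PDF p.102)] -/
def LinearlyReachableFromBN : Prop :=
  ∀ S : C, 𝔉.IsThetaSaturated S → ∃ φ : 𝔉.BN ⟶ S, 𝔉.IsLinear φ ∧
    Function.Surjective (𝔉.lDeltaModNMap φ) ∧ Function.Injective (𝔉.muTorsionPull φ 𝔉.N)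

/-- The uniqueness half of Prop. 5.5 PROVED from the transport step: two rigidity families that are
functorial for linear morphisms and agree on `B_N` agree on every theta-saturated object ("independent
of the choice … precisely because of the original 'functoriality'", p.328 (PDF p.102)).
[cite: MochizukiEtTh2009, Prop 5.5 proof p.328 (PDF p.102)] -/
theorem rigidityFamily_unique_of (hreach : LinearlyReachableFromBN 𝔉) (hB : 𝔉.IsThetaSaturated 𝔉.BN)
    {ρ ρ' : RigidityFamily 𝔉} (hρ : IsFunctorialLinear 𝔉 ρ) (hρ' : IsFunctorialLinear 𝔉 ρ')
    (hBN : ρ 𝔉.BN hB = ρ' 𝔉.BN hB) : ρ = ρ' := by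
  funext S hS
  obtain ⟨φ, hlin, hsurj, hinj⟩ := hreach S hS
  apply MulEquiv.ext
  intro y
  obtain ⟨x, rfl⟩ := hsurj y
  apply hinj
  rw [hρ φ hlin hB hS x, hρ' φ hlin hB hS x, hBN]

/-! ### Theorem 5.6 -/

/-- **[EtTh] Theorem 5.6**, first clause (p.328 (PDF p.102)): the self-equivalence `Ψ : C ⥲ C` "preserves the
`(l, N)`-theta-saturated objects".  [cite: MochizukiEtTh2009, Thm 5.6 p.328 (PDF p.102)] -/
def PreservesThetaSaturated (Ψ : C ≌ C) : Prop :=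
  ∀ S : C, 𝔉.IsThetaSaturated S ↔ 𝔉.IsThetaSaturated (Ψ.functor.obj S)

/-- `Ψ` preserves the cyclotomes: `Ψ` maps `μ_N(S) ⊆ Aut_C(S)` into `μ_N(Ψ(S))` (proof of Thm. 5.6,
p.328 (PDF p.102): "`Ψ` preserves '`O^×(−)`'" by Prop. 5.1 and [FrdI] Thm. 3.4 (iv)).
[cite: MochizukiEtTh2009, Thm 5.6 proof p.328 (PDF p.102)] -/
def PreservesCyclotomes (Ψ : C ≌ C) : Prop :=
  ∀ (S : C) (u : Aut S), u ∈ 𝔉.muTorsion S 𝔉.N → Ψ.functor.mapAut S u ∈ 𝔉.muTorsion (Ψ.functor.obj S) 𝔉.N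

/-- **[EtTh] Theorem 5.6**, second clause (p.328 (PDF p.102)): `Ψ` preserves "the natural isomorphism
`(l·Δ_Θ)_S ⊗ ℤ/Nℤ ⥲ μ_N(S)` … of Proposition 5.5 [i.e., `Ψ` transports this isomorphism for `S` to
the corresponding isomorphism for `Ψ(S)`]".  PARAMETER `aΨ`: the transport
`(l·Δ_Θ)_S ⊗ ℤ/Nℤ ⥲ (l·Δ_Θ)_{Ψ(S)} ⊗ ℤ/Nℤ` induced by the 1-compatible self-equivalence `Ψ^bs` of `D`
and the characteristic nature of `(l·Δ_Θ)_{(−)}` (Props. 2.4, 2.6; Cor. 3.8), to be supplied by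
abc-iut-L2-t2/t3's decls; on `μ_N` the transport is `Ψ.mapAut`.
[cite: MochizukiEtTh2009, Thm 5.6 p.328 (PDF p.102)] -/
def PreservesRigidityIso (Ψ : C ≌ C) (ρ : RigidityFamily 𝔉)
    (aΨ : ∀ S : C, 𝔉.lDeltaModN S ≃* 𝔉.lDeltaModN (Ψ.functor.obj S)) : Prop :=
  PreservesCyclotomes 𝔉 Ψ ∧
    ∀ (S : C) (hS : 𝔉.IsThetaSaturated S) (hΨS : 𝔉.IsThetaSaturated (Ψ.functor.obj S))
      (x : 𝔉.lDeltaModN S),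
      (Ψ.functor.mapAut S (ρ S hS x : Aut S) : Aut (Ψ.functor.obj S)) = ρ (Ψ.functor.obj S) hΨS (aΨ S x)

/-- **[EtTh] Theorem 5.6 (Category-theoreticity of Frobenioid-theoretic Cyclotomic Rigidity)**
(p.328 (PDF p.102)), both clauses, for the §5 Frobenioid `C`, a self-equivalence `Ψ`, "`N ≥ 1` an integer":
"`Ψ` preserves the `(l, N)`-theta-saturated objects, as well as the natural isomorphism
`(l·Δ_Θ)_S ⊗ ℤ/Nℤ ⥲ μ_N(S) (= l·μ_{l·N}(S))` [for `(l, N)`-theta-saturated `S ∈ Ob(C)`] of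
Proposition 5.5."  [cite: MochizukiEtTh2009, Thm 5.6 p.328 (PDF p.102)] -/
def CyclotomicRigidityPreserved (Ψ : C ≌ C) (ρ : RigidityFamily 𝔉)
    (aΨ : ∀ S : C, 𝔉.lDeltaModN S ≃* 𝔉.lDeltaModN (Ψ.functor.obj S)) : Prop :=
  PreservesThetaSaturated 𝔉 Ψ ∧ PreservesRigidityIso 𝔉 Ψ ρ aΨ

/-! ### Theorem 5.7 -/

/-- **LOCAL STUB — `TODO-merge(abc-iut-L2-t3, abc-iut-L2-t2, abc-iut-L2-t1)`.**  The class of pairs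
of morphisms of `C` that Theorem 5.7 says is preserved: "right fraction-pairs of [the
Frobenioid-theoretic version of the log-meromorphic function constituted by] an `l`-th root of the
theta function `Θ̈(√−1)⁻¹ · Θ̈` of Proposition 1.4 [normalized so as to be 'of standard type'], up to
possible multiplication by a `2l`-th root of unity and possible translation by an element of
`ℤ (≅ Gal(Ÿ/Ẋ))` [when '`A`' arises from `X̲^log`, `Ẋ̲^log`] or `l·ℤ` [when '`A`' arises from
`C̲^log`, `Ċ̲^log`, `X̳^log`, `Ẋ̳^log`, `C̳^log`, `Ċ̳^log`]" (pp.329–330 (PDF pp.103–104)).  Ingredients owned by t3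
(right fraction-pairs, Def. 4.1 (i)), t1 (`Θ̈`, its value at `√−1`, standard type: Prop. 1.4,
Def. 1.9) and t2 (the Galois translates, Def. 2.7).
[cite: MochizukiEtTh2009, Thm 5.7 p.329–330 (PDF pp.103–104)] -/
structure StdThetaPairStub (𝔉 : ThetaFrobenioid.{w} C D) where
  /-- `(s, s')` is a right fraction-pair of a member of the `μ_{2l} × (ℤ or l·ℤ)`-orbit of
  `l`-th roots of `Θ̈(√−1)⁻¹ · Θ̈` of standard type. -/
  IsStdThetaRootFractionPair : ∀ {A B : C}, (A ⟶ B) → (A ⟶ B) → Prop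

/-- **[EtTh] Theorem 5.7 (Category-theoreticity of the Frobenioid-theoretic Theta Function)**
(pp.329–330 (PDF pp.103–104)): "In the notation of Theorem 5.6, `Ψ` preserves right fraction-pairs of [… ] an `l`-th
root of the theta function `Θ̈(√−1)⁻¹ · Θ̈` of Proposition 1.4 [normalized so as to be 'of standard
type'], up to possible multiplication by a `2l`-th root of unity and possible translation by an
element of `ℤ` … or `l·ℤ` …."  Typed: `Ψ` maps the class `IsStdThetaRootFractionPair` into itself.
[cite: MochizukiEtTh2009, Thm 5.7 p.329–330 (PDF pp.103–104)] -/
def ThetaFunctionPreserved (V : StdThetaPairStub 𝔉) (Ψ : C ≌ C) : Prop :=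
  ∀ {A B : C} (s s' : A ⟶ B), V.IsStdThetaRootFractionPair s s' →
    V.IsStdThetaRootFractionPair (Ψ.functor.map s) (Ψ.functor.map s')

end FrobenioidCyclotomicRigidity

end Literature.AnabelianGeometry.EtaleTheta
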